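import Literature.Analysis.FluidPDE.Antidivergence
import Literature.Analysis.FunctionSpaces.TorusInverseLaplacianL2
import HarnessLib

/-!
# The antidivergence `ℛ` is bounded on `L²(𝕋^d)`

Analysis/FluidPDE support file (all results proved). Cheskidov–Luo 2022, Thm. 7.3 states that the
De Lellis–Székelyhidi antidivergence `ℛ` (Def. 7.2, `Torus.antidivergence`) is bounded on every
`L^p(𝕋^d)`, `1 ≤ p ≤ ∞` (a Calderón–Zygmund fact). This file proves the `p = 2` case, which is
all that the Calderón–Zygmund-free proof of CL22 Prop. 4.1 in this series uses: from the formula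
`(ℛv)ᵢⱼ = ∂ᵢuⱼ + ∂ⱼuᵢ - (1/(d-1)) δᵢⱼ D + ((2-d)/(d-1)) ∂ᵢ∂ⱼΔ⁻¹D`, `u = Δ⁻¹v`, `D = div u`, and
the Parseval bounds `‖∂ᵢΔ⁻¹h‖₂ ≤ (2π)⁻¹‖h‖₂`, `‖∂ᵢ∂ⱼΔ⁻¹h‖₂ ≤ ‖h‖₂` of `TorusInverseLaplacianL2`,

  `‖ℛv‖_{L²} ≤ C_d ‖v‖_{L²}`   (`eLpNorm_antidivergence_le`),

with an explicit `C_d = antidivergenceL2Const d` (column-sup norm on the tensor values).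
Auxiliary: `L²` norms of continuous real functions on the torus through `∫ g²`
(`eLpNorm_two_eq_ofReal_sqrt`), comparison of `L²` norms from a comparison of `∫ g²`, and
`‖vⱼ‖_p ≤ ‖v‖_p`.

## References

* A. Cheskidov, X. Luo, arXiv:2009.06596, §7.2 Def. 7.2, Thm. 7.3. [`CheskidovLuo2022`]
* C. De Lellis, L. Székelyhidi Jr., Invent. Math. 193 (2013), §4.1.
-/

noncomputable section

open Set Filter Topology Function MeasureTheory Finset
open scoped ENNReal

namespace Literature.Analysis.FluidPDE

namespace Torus

open FunctionSpaces FunctionSpaces.Torus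

variable {d : Type*} [Fintype d] [DecidableEq d]

/-! ## `L²` norms of continuous functions on the torus -/

section L2

omit [DecidableEq d] in
/-- `‖g‖_{L²} = (∫ g²)^{1/2}` for continuous real `g` on the torus. [folklore] -/
theorem eLpNorm_two_eq_ofReal_sqrt {g : UnitAddTorus d → ℝ} (hg : Continuous g) :
    eLpNorm g 2 volume = ENNReal.ofReal (Real.sqrt (∫ y, g y ^ 2)) := by
  obtain ⟨B, hB⟩ := (isCompact_univ.image hg).isBounded.exists_norm_le
  have hmem : MemLp g 2 volume :=
    (memLp_top_of_bound hg.aestronglyMeasurable B (Eventually.of_forall fun y => hB _ ⟨y, mem_univ _, rfl⟩)).mono_exponent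
      le_top
  rw [hmem.eLpNorm_eq_integral_rpow_norm two_ne_zero ENNReal.ofNat_ne_top, Real.sqrt_eq_rpow]
  norm_num

omit [DecidableEq d] in
/-- Comparison of `L²` norms from a comparison of square integrals: if `∫ g² ≤ C² ∫ h²`, `C ≥ 0`,
then `‖g‖₂ ≤ C ‖h‖₂` (continuous real `g`, `h`). [folklore] -/
theorem eLpNorm_two_le_of_integral_sq_le {g h : UnitAddTorus d → ℝ} (hg : Continuous g) (hh : Continuous h)
    {C : ℝ} (hC : 0 ≤ C) (hle : ∫ y, g y ^ 2 ≤ C ^ 2 * ∫ y, h y ^ 2) :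
    eLpNorm g 2 volume ≤ ENNReal.ofReal C * eLpNorm h 2 volume := by
  rw [eLpNorm_two_eq_ofReal_sqrt hg, eLpNorm_two_eq_ofReal_sqrt hh, ← ENNReal.ofReal_mul hC]
  refine ENNReal.ofReal_le_ofReal ?_
  rw [← Real.sqrt_sq hC, ← Real.sqrt_mul (sq_nonneg C)]
  exact Real.sqrt_le_sqrt hle

omit [DecidableEq d] in
/-- Coordinates are dominated in `L^p`: `‖vⱼ‖_p ≤ ‖v‖_p`. [folklore] -/
theorem eLpNorm_apply_le (v : UnitAddTorus d → EuclideanSpace ℝ d) (j : d) (p : ℝ≥0∞) :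
    eLpNorm (fun y => v y j) p volume ≤ eLpNorm v p volume :=
  eLpNorm_mono fun y => (Real.norm_eq_abs _).le.trans ((Real.norm_eq_abs _).symm.le.trans (PiLp.norm_apply_le (v y) j))

end L2

/-! ## The `L²` bound for `ℛ` -/

section Bound

variable (d) in
/-- An explicit constant `C_d` with `‖ℛv‖_{L²} ≤ C_d‖v‖_{L²}`:
`C_d = d² (2π)⁻¹ (2 + d/(d-1) + d|2-d|/(d-1))`. [folklore] -/
def antidivergenceL2Const : ℝ :=
  (Fintype.card d : ℝ) ^ 2 * ((2 * Real.pi)⁻¹ *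
    (2 + (Fintype.card d : ℝ) * |1 / ((Fintype.card d : ℝ) - 1)| +
      (Fintype.card d : ℝ) * |(2 - (Fintype.card d : ℝ)) / ((Fintype.card d : ℝ) - 1)|))

omit [DecidableEq d] in
/-- `0 ≤ C_d`. [folklore] -/
theorem antidivergenceL2Const_nonneg : 0 ≤ antidivergenceL2Const d := by
  unfold antidivergenceL2Const; positivity

variable {v : UnitAddTorus d → EuclideanSpace ℝ d}

/-- `‖∂ᵢ Δ⁻¹vⱼ‖₂ ≤ (2π)⁻¹ ‖v‖₂`. [folklore] -/
theorem eLpNorm_partialDeriv_antidivPotential_le [Nonempty d] (hv : IsSmooth v) (i j : d) :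
    eLpNorm (partialDeriv i (antidivPotential v j)) 2 volume ≤ ENNReal.ofReal ((2 * Real.pi)⁻¹) * eLpNorm v 2 volume := by
  have hvj : IsSmooth (fun y => v y j) := hv.apply j
  have h1 := integral_sq_partialDeriv_invLaplacian_le hvj i
  have h2 : eLpNorm (partialDeriv i (antidivPotential v j)) 2 volume ≤
      ENNReal.ofReal ((2 * Real.pi)⁻¹) * eLpNorm (fun y => v y j) 2 volume :=
    eLpNorm_two_le_of_integral_sq_le ((isSmooth_antidivPotential hv j).partialDeriv i).continuous hvj.continuous
      (by positivity) h1
  exact h2.trans (mul_le_mul' le_rfl (eLpNorm_apply_le v j 2))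

/-- `‖D‖₂ ≤ d (2π)⁻¹ ‖v‖₂` for `D = div Δ⁻¹v`. [folklore] -/
theorem eLpNorm_antidivDiv_le [Nonempty d] (hv : IsSmooth v) :
    eLpNorm (antidivDiv v) 2 volume ≤ ENNReal.ofReal ((Fintype.card d : ℝ) * (2 * Real.pi)⁻¹) * eLpNorm v 2 volume := by
  have hmeas : ∀ l, AEStronglyMeasurable (partialDeriv l (antidivPotential v l)) volume := fun l =>
    ((isSmooth_antidivPotential hv l).partialDeriv l).continuous.aestronglyMeasurable
  have e : antidivDiv v = ∑ l : d, partialDeriv l (antidivPotential v l) := by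
    funext y; simp [antidivDiv, Finset.sum_apply]
  rw [e]
  calc eLpNorm (∑ l : d, partialDeriv l (antidivPotential v l)) 2 volume
      ≤ ∑ l : d, eLpNorm (partialDeriv l (antidivPotential v l)) 2 volume :=
        eLpNorm_sum_le (fun l _ => hmeas l) one_le_two
    _ ≤ ∑ _l : d, ENNReal.ofReal ((2 * Real.pi)⁻¹) * eLpNorm v 2 volume :=
        Finset.sum_le_sum fun l _ => eLpNorm_partialDeriv_antidivPotential_le hv l l
    _ = ENNReal.ofReal ((Fintype.card d : ℝ) * (2 * Real.pi)⁻¹) * eLpNorm v 2 volume := by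
        rw [Finset.sum_const, Finset.card_univ, nsmul_eq_mul, ← mul_assoc, ENNReal.ofReal_mul (by positivity),
          ENNReal.ofReal_natCast]

/-- `‖∂ᵢ∂ⱼφ‖₂ ≤ ‖D‖₂` for `φ = Δ⁻¹D`. [folklore] -/
theorem eLpNorm_partialDeriv_partialDeriv_antidivPhi_le [Nonempty d] (hv : IsSmooth v) (i j : d) :
    eLpNorm (partialDeriv i (partialDeriv j (antidivPhi v))) 2 volume ≤ eLpNorm (antidivDiv v) 2 volume := by
  have hD := isSmooth_antidivDiv hv
  have h1 := integral_sq_partialDeriv_partialDeriv_invLaplacian_le hD i j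
  have h2 := eLpNorm_two_le_of_integral_sq_le (((isSmooth_antidivPhi hv).partialDeriv j).partialDeriv i).continuous
    hD.continuous zero_le_one (by simpa [antidivPhi] using h1)
  simpa using h2

/-- `L²` bound for one entry of `ℛv`. [folklore] -/
theorem eLpNorm_antidivEntry_le (hd : 2 ≤ Fintype.card d) (hv : IsSmooth v) (i j : d) :
    eLpNorm (antidivEntry v i j) 2 volume ≤
      ENNReal.ofReal ((2 * Real.pi)⁻¹ * (2 + (Fintype.card d : ℝ) * |1 / ((Fintype.card d : ℝ) - 1)| +
        (Fintype.card d : ℝ) * |(2 - (Fintype.card d : ℝ)) / ((Fintype.card d : ℝ) - 1)|)) * eLpNorm v 2 volume := by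
  haveI : Nonempty d := Fintype.card_pos_iff.1 (by omega)
  set a : ℝ := (2 * Real.pi)⁻¹ with ha
  set N : ℝ := (Fintype.card d : ℝ) with hN
  set c₁ : ℝ := 1 / (N - 1) with hc₁
  set c₂ : ℝ := (2 - N) / (N - 1) with hc₂
  have ha0 : 0 ≤ a := by positivity
  -- the four pieces
  set f₁ := partialDeriv i (antidivPotential v j) with hf₁
  set f₂ := partialDeriv j (antidivPotential v i) with hf₂
  set f₃ : UnitAddTorus d → ℝ := fun y => c₁ * (if i = j then antidivDiv v y else 0) with hf₃
  set f₄ : UnitAddTorus d → ℝ := fun y => c₂ * partialDeriv i (partialDeriv j (antidivPhi v)) y with hf₄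
  have hm₁ : AEStronglyMeasurable f₁ volume := ((isSmooth_antidivPotential hv j).partialDeriv i).continuous.aestronglyMeasurable
  have hm₂ : AEStronglyMeasurable f₂ volume := ((isSmooth_antidivPotential hv i).partialDeriv j).continuous.aestronglyMeasurable
  have hm₃ : AEStronglyMeasurable f₃ volume := (isSmooth_ite_antidivDiv hv i j).continuous.aestronglyMeasurable.const_mul _
  have hm₄ : AEStronglyMeasurable f₄ volume :=
    (((isSmooth_antidivPhi hv).partialDeriv j).partialDeriv i).continuous.aestronglyMeasurable.const_mul _
  have e : antidivEntry v i j = fun y => ((f₁ y + f₂ y) - f₃ y) + f₄ y := rfl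
  -- bounds
  have b₁ := eLpNorm_partialDeriv_antidivPotential_le hv i j
  have b₂ := eLpNorm_partialDeriv_antidivPotential_le hv j i
  have b₃ : eLpNorm f₃ 2 volume ≤ ENNReal.ofReal (|c₁| * (N * a)) * eLpNorm v 2 volume := by
    have e3 : f₃ = c₁ • fun y => (if i = j then antidivDiv v y else 0) := rfl
    rw [e3, eLpNorm_const_smul, ENNReal.ofReal_mul (abs_nonneg _), ← Real.enorm_eq_ofReal_abs, mul_assoc]
    gcongr
    by_cases hij : i = j
    · simp only [hij, if_true]; exact eLpNorm_antidivDiv_le hv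
    · simp only [hij, if_false, eLpNorm_zero']; simp
  have b₄ : eLpNorm f₄ 2 volume ≤ ENNReal.ofReal (|c₂| * (N * a)) * eLpNorm v 2 volume := by
    have e4 : f₄ = c₂ • partialDeriv i (partialDeriv j (antidivPhi v)) := rfl
    rw [e4, eLpNorm_const_smul, ENNReal.ofReal_mul (abs_nonneg _), ← Real.enorm_eq_ofReal_abs, mul_assoc]
    gcongr
    exact (eLpNorm_partialDeriv_partialDeriv_antidivPhi_le hv i j).trans (eLpNorm_antidivDiv_le hv)
  -- Minkowski
  rw [e]
  calc eLpNorm (fun y => ((f₁ y + f₂ y) - f₃ y) + f₄ y) 2 volume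
      ≤ eLpNorm (fun y => (f₁ y + f₂ y) - f₃ y) 2 volume + eLpNorm f₄ 2 volume :=
        eLpNorm_add_le ((hm₁.add hm₂).sub hm₃) hm₄ one_le_two
    _ ≤ (eLpNorm (fun y => f₁ y + f₂ y) 2 volume + eLpNorm f₃ 2 volume) + eLpNorm f₄ 2 volume := by
        gcongr; exact eLpNorm_sub_le (hm₁.add hm₂) hm₃ one_le_two
    _ ≤ ((eLpNorm f₁ 2 volume + eLpNorm f₂ 2 volume) + eLpNorm f₃ 2 volume) + eLpNorm f₄ 2 volume := by
        gcongr; exact eLpNorm_add_le hm₁ hm₂ one_le_two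
    _ ≤ ((ENNReal.ofReal a * eLpNorm v 2 volume + ENNReal.ofReal a * eLpNorm v 2 volume) +
          ENNReal.ofReal (|c₁| * (N * a)) * eLpNorm v 2 volume) + ENNReal.ofReal (|c₂| * (N * a)) * eLpNorm v 2 volume := by
        gcongr
    _ = ENNReal.ofReal (a * (2 + N * |c₁| + N * |c₂|)) * eLpNorm v 2 volume := by
        rw [← add_mul, ← add_mul, ← add_mul, ← ENNReal.ofReal_add ha0 ha0,
          ← ENNReal.ofReal_add (by positivity) (by positivity), ← ENNReal.ofReal_add (by positivity) (by positivity)]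
        congr 1; congr 1; ring

omit [DecidableEq d] in
/-- The Euclidean norm is bounded by the sum of the coordinates' absolute values (private copy;
public versions exist in `NSFourierAPriori`, `OnsagerBDSVProofs`, not in this import closure). [folklore] -/
private theorem norm_le_sum_abs_apply' (x : EuclideanSpace ℝ d) : ‖x‖ ≤ ∑ i, |x i| := by
  have hS : 0 ≤ ∑ i, |x i| := Finset.sum_nonneg fun i _ => abs_nonneg _
  rw [EuclideanSpace.norm_eq, Real.sqrt_le_left hS, sq, Finset.sum_mul]
  refine Finset.sum_le_sum fun i _ => ?_
  rw [Real.norm_eq_abs, sq]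
  exact mul_le_mul_of_nonneg_left (Finset.single_le_sum (f := fun j => |x j|) (fun j _ => abs_nonneg _)
    (Finset.mem_univ i)) (abs_nonneg _)

omit [DecidableEq d] in
/-- The column-sup norm of a tensor is bounded by the sum of the absolute values of its entries
(cf. `Torus.norm_tensor_le_sum_abs` of `NavierStokesCorrectorAntidivergenceBound`, not imported). [folklore] -/
theorem norm_tensor_le_sum_sum_abs (T : d → EuclideanSpace ℝ d) : ‖T‖ ≤ ∑ j, ∑ i, |T j i| := by
  refine (pi_norm_le_iff_of_nonneg (Finset.sum_nonneg fun j _ => Finset.sum_nonneg fun i _ => abs_nonneg _)).2 fun j => ?_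
  exact (norm_le_sum_abs_apply' (T j)).trans
    (Finset.single_le_sum (f := fun j => ∑ i, |T j i|) (fun j _ => Finset.sum_nonneg fun i _ => abs_nonneg _) (Finset.mem_univ j))

/-- **`ℛ` is bounded on `L²(𝕋^d)`**: `‖ℛv‖_{L²} ≤ C_d ‖v‖_{L²}` for smooth `v`, `d ≥ 2`
(Cheskidov–Luo 2022, Thm. 7.3, the case `p = 2`, by Parseval; here without the zero-mean
restriction of the printed statement). [cite: CheskidovLuo2022, Thm. 7.3] -/
theorem eLpNorm_antidivergence_le (hd : 2 ≤ Fintype.card d) (hv : IsSmooth v) :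
    eLpNorm (antidivergence v) 2 volume ≤ ENNReal.ofReal (antidivergenceL2Const d) * eLpNorm v 2 volume := by
  set K : ℝ := (2 * Real.pi)⁻¹ * (2 + (Fintype.card d : ℝ) * |1 / ((Fintype.card d : ℝ) - 1)| +
        (Fintype.card d : ℝ) * |(2 - (Fintype.card d : ℝ)) / ((Fintype.card d : ℝ) - 1)|) with hK
  have hK0 : 0 ≤ K := by positivity
  have hent : ∀ i j, eLpNorm (antidivEntry v i j) 2 volume ≤ ENNReal.ofReal K * eLpNorm v 2 volume :=
    fun i j => eLpNorm_antidivEntry_le hd hv i j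
  have hmeas : ∀ i j, AEStronglyMeasurable (fun y => |antidivEntry v i j y|) volume := fun i j =>
    (isSmooth_antidivEntry hv i j).continuous.abs.aestronglyMeasurable
  -- pointwise domination by the sum of the entries
  have hpt : ∀ y, ‖antidivergence v y‖ ≤ ∑ q : d × d, |antidivEntry v q.2 q.1 y| := by
    intro y
    refine (norm_tensor_le_sum_sum_abs (antidivergence v y)).trans (le_of_eq ?_)
    rw [Fintype.sum_prod_type]
    simp [antidivergence_apply]
  have e : (fun y => ∑ q : d × d, |antidivEntry v q.2 q.1 y|) = ∑ q : d × d, fun y => |antidivEntry v q.2 q.1 y| :=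
    (Finset.sum_fn _ _).symm
  calc eLpNorm (antidivergence v) 2 volume
      ≤ eLpNorm (fun y => ∑ q : d × d, |antidivEntry v q.2 q.1 y|) 2 volume := eLpNorm_mono_real hpt
    _ = eLpNorm (∑ q : d × d, fun y => |antidivEntry v q.2 q.1 y|) 2 volume := by rw [e]
    _ ≤ ∑ q : d × d, eLpNorm (fun y => |antidivEntry v q.2 q.1 y|) 2 volume :=
        eLpNorm_sum_le (fun q _ => hmeas q.2 q.1) one_le_two
    _ = ∑ q : d × d, eLpNorm (antidivEntry v q.2 q.1) 2 volume :=
        Finset.sum_congr rfl fun q _ => eLpNorm_norm (antidivEntry v q.2 q.1)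
    _ ≤ ∑ _q : d × d, ENNReal.ofReal K * eLpNorm v 2 volume := Finset.sum_le_sum fun q _ => hent q.2 q.1
    _ = ENNReal.ofReal (antidivergenceL2Const d) * eLpNorm v 2 volume := by
        rw [Finset.sum_const, Finset.card_univ, Fintype.card_prod, nsmul_eq_mul, ← mul_assoc]
        congr 1
        have hn : ((Fintype.card d * Fintype.card d : ℕ) : ℝ≥0∞) = ENNReal.ofReal ((Fintype.card d : ℝ) ^ 2) := by
          rw [sq, ← Nat.cast_mul, ENNReal.ofReal_natCast]
        rw [hn, ← ENNReal.ofReal_mul (by positivity), hK, antidivergenceL2Const]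

end Bound

end Torus

end Literature.Analysis.FluidPDE
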